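import Summits.CriticalPhenomena.PercolationContinuityZ3.Theorems.PercNearOneGluingNoHeavyLowerTailSahiThreeCopyCellX7bMasks2

/-!
# `NoHeavyLowerTail` (crux stmt-CriticalPhenomena-4575), Sahi programme: `LawGood` for the slot `X7b` at the interior profiles, mask by mask (part 3)

Support file (Sahi cell, seat `prim-sahi-p1`, generation 65; `--supports stmt-CriticalPhenomena-4575`).  Each interior profile `prof7 m` is a relabelling
(by an automorphism of the slot) of a certified class representative (`…CellX7bp*` / class files); COMPUTATIONAL only through `native_decide` on the
invariance of the slot under the relabelling (a `Finset (Pt 7)` identity) and the inherited cell checks. [this work]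
-/

namespace Summit.CriticalPhenomena.PercolationContinuityZ3.Theorems.SahiThreeCopy

open Finset Function Literature.Combinatorics.Sahi2008
open scoped BigOperators

/-- Interior profile `prof7 110` (relabelled from the class representative `prof7 122`). [this work] -/
theorem lawGood_X7bm110 : LawGood 7 (prof7 110) (setInd X7bSet) := by
  have h := lawGood_relab (k := 7) ((Equiv.swap (2 : Fin 7) 4).trans (Equiv.swap (3 : Fin 7) 5)) (π := prof7 122) (f := (setInd X7bSet))
    (by rw [setInd_comp_relab, show X7bSet.map (relab ((Equiv.swap (2 : Fin 7) 4).trans (Equiv.swap (3 : Fin 7) 5))).symm.toEmbedding = X7bSet by native_decide]; exact lawGood_X7b1212222)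
  have hπ : prof7 110 = prof7 122 ∘ ((Equiv.swap (2 : Fin 7) 4).trans (Equiv.swap (3 : Fin 7) 5)) := by funext i; fin_cases i <;> rfl
  rw [hπ]; exact h

/-- Interior profile `prof7 111` (relabelled from the class representative `prof7 126`). [this work] -/
theorem lawGood_X7bm111 : LawGood 7 (prof7 111) (setInd X7bSet) := by
  have h := lawGood_relab (k := 7) ((((Equiv.swap (0 : Fin 7) 2).trans (Equiv.swap (1 : Fin 7) 3)).trans (Equiv.swap (0 : Fin 7) 4)).trans (Equiv.swap (1 : Fin 7) 5)) (π := prof7 126) (f := (setInd X7bSet))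
    (by rw [setInd_comp_relab, show X7bSet.map (relab ((((Equiv.swap (0 : Fin 7) 2).trans (Equiv.swap (1 : Fin 7) 3)).trans (Equiv.swap (0 : Fin 7) 4)).trans (Equiv.swap (1 : Fin 7) 5))).symm.toEmbedding = X7bSet by native_decide]; exact lawGood_X7b1222222)
  have hπ : prof7 111 = prof7 126 ∘ ((((Equiv.swap (0 : Fin 7) 2).trans (Equiv.swap (1 : Fin 7) 3)).trans (Equiv.swap (0 : Fin 7) 4)).trans (Equiv.swap (1 : Fin 7) 5)) := by funext i; fin_cases i <;> rfl
  rw [hπ]; exact h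

/-- Interior profile `prof7 113` (relabelled from the class representative `prof7 120`). [this work] -/
theorem lawGood_X7bm113 : LawGood 7 (prof7 113) (setInd X7bSet) := by
  have h := lawGood_relab (k := 7) (((Equiv.swap (0 : Fin 7) 3).trans (Equiv.swap (1 : Fin 7) 2)).trans (Equiv.swap (1 : Fin 7) 0)) (π := prof7 120) (f := (setInd X7bSet))
    (by rw [setInd_comp_relab, show X7bSet.map (relab (((Equiv.swap (0 : Fin 7) 3).trans (Equiv.swap (1 : Fin 7) 2)).trans (Equiv.swap (1 : Fin 7) 0))).symm.toEmbedding = X7bSet by native_decide]; exact lawGood_X7b1112222)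
  have hπ : prof7 113 = prof7 120 ∘ (((Equiv.swap (0 : Fin 7) 3).trans (Equiv.swap (1 : Fin 7) 2)).trans (Equiv.swap (1 : Fin 7) 0)) := by funext i; fin_cases i <;> rfl
  rw [hπ]; exact h

/-- Interior profile `prof7 114` (relabelled from the class representative `prof7 120`). [this work] -/
theorem lawGood_X7bm114 : LawGood 7 (prof7 114) (setInd X7bSet) := by
  have h := lawGood_relab (k := 7) ((Equiv.swap (0 : Fin 7) 2).trans (Equiv.swap (1 : Fin 7) 3)) (π := prof7 120) (f := (setInd X7bSet))
    (by rw [setInd_comp_relab, show X7bSet.map (relab ((Equiv.swap (0 : Fin 7) 2).trans (Equiv.swap (1 : Fin 7) 3))).symm.toEmbedding = X7bSet by native_decide]; exact lawGood_X7b1112222)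
  have hπ : prof7 114 = prof7 120 ∘ ((Equiv.swap (0 : Fin 7) 2).trans (Equiv.swap (1 : Fin 7) 3)) := by funext i; fin_cases i <;> rfl
  rw [hπ]; exact h

/-- Interior profile `prof7 115` (relabelled from the class representative `prof7 124`). [this work] -/
theorem lawGood_X7bm115 : LawGood 7 (prof7 115) (setInd X7bSet) := by
  have h := lawGood_relab (k := 7) ((Equiv.swap (0 : Fin 7) 2).trans (Equiv.swap (1 : Fin 7) 3)) (π := prof7 124) (f := (setInd X7bSet))
    (by rw [setInd_comp_relab, show X7bSet.map (relab ((Equiv.swap (0 : Fin 7) 2).trans (Equiv.swap (1 : Fin 7) 3))).symm.toEmbedding = X7bSet by native_decide]; exact lawGood_X7b1122222)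
  have hπ : prof7 115 = prof7 124 ∘ ((Equiv.swap (0 : Fin 7) 2).trans (Equiv.swap (1 : Fin 7) 3)) := by funext i; fin_cases i <;> rfl
  rw [hπ]; exact h

/-- Interior profile `prof7 116` (relabelled from the class representative `prof7 120`). [this work] -/
theorem lawGood_X7bm116 : LawGood 7 (prof7 116) (setInd X7bSet) := by
  have h := lawGood_relab (k := 7) (Equiv.swap (2 : Fin 7) 3) (π := prof7 120) (f := (setInd X7bSet))
    (by rw [setInd_comp_relab, show X7bSet.map (relab (Equiv.swap (2 : Fin 7) 3)).symm.toEmbedding = X7bSet by native_decide]; exact lawGood_X7b1112222)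
  have hπ : prof7 116 = prof7 120 ∘ (Equiv.swap (2 : Fin 7) 3) := by funext i; fin_cases i <;> rfl
  rw [hπ]; exact h

/-- Interior profile `prof7 117` (relabelled from the class representative `prof7 122`). [this work] -/
theorem lawGood_X7bm117 : LawGood 7 (prof7 117) (setInd X7bSet) := by
  have h := lawGood_relab (k := 7) ((Equiv.swap (0 : Fin 7) 1).trans (Equiv.swap (2 : Fin 7) 3)) (π := prof7 122) (f := (setInd X7bSet))
    (by rw [setInd_comp_relab, show X7bSet.map (relab ((Equiv.swap (0 : Fin 7) 1).trans (Equiv.swap (2 : Fin 7) 3))).symm.toEmbedding = X7bSet by native_decide]; exact lawGood_X7b1212222)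
  have hπ : prof7 117 = prof7 122 ∘ ((Equiv.swap (0 : Fin 7) 1).trans (Equiv.swap (2 : Fin 7) 3)) := by funext i; fin_cases i <;> rfl
  rw [hπ]; exact h

/-- Interior profile `prof7 118` (relabelled from the class representative `prof7 122`). [this work] -/
theorem lawGood_X7bm118 : LawGood 7 (prof7 118) (setInd X7bSet) := by
  have h := lawGood_relab (k := 7) (Equiv.swap (2 : Fin 7) 3) (π := prof7 122) (f := (setInd X7bSet))
    (by rw [setInd_comp_relab, show X7bSet.map (relab (Equiv.swap (2 : Fin 7) 3)).symm.toEmbedding = X7bSet by native_decide]; exact lawGood_X7b1212222)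
  have hπ : prof7 118 = prof7 122 ∘ (Equiv.swap (2 : Fin 7) 3) := by funext i; fin_cases i <;> rfl
  rw [hπ]; exact h

/-- Interior profile `prof7 119` (relabelled from the class representative `prof7 126`). [this work] -/
theorem lawGood_X7bm119 : LawGood 7 (prof7 119) (setInd X7bSet) := by
  have h := lawGood_relab (k := 7) (((Equiv.swap (0 : Fin 7) 2).trans (Equiv.swap (1 : Fin 7) 3)).trans (Equiv.swap (0 : Fin 7) 1)) (π := prof7 126) (f := (setInd X7bSet))
    (by rw [setInd_comp_relab, show X7bSet.map (relab (((Equiv.swap (0 : Fin 7) 2).trans (Equiv.swap (1 : Fin 7) 3)).trans (Equiv.swap (0 : Fin 7) 1))).symm.toEmbedding = X7bSet by native_decide]; exact lawGood_X7b1222222)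
  have hπ : prof7 119 = prof7 126 ∘ (((Equiv.swap (0 : Fin 7) 2).trans (Equiv.swap (1 : Fin 7) 3)).trans (Equiv.swap (0 : Fin 7) 1)) := by funext i; fin_cases i <;> rfl
  rw [hπ]; exact h

/-- Interior profile `prof7 121` (relabelled from the class representative `prof7 122`). [this work] -/
theorem lawGood_X7bm121 : LawGood 7 (prof7 121) (setInd X7bSet) := by
  have h := lawGood_relab (k := 7) (Equiv.swap (0 : Fin 7) 1) (π := prof7 122) (f := (setInd X7bSet))
    (by rw [setInd_comp_relab, show X7bSet.map (relab (Equiv.swap (0 : Fin 7) 1)).symm.toEmbedding = X7bSet by native_decide]; exact lawGood_X7b1212222)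
  have hπ : prof7 121 = prof7 122 ∘ (Equiv.swap (0 : Fin 7) 1) := by funext i; fin_cases i <;> rfl
  rw [hπ]; exact h

/-- Interior profile `prof7 123` (relabelled from the class representative `prof7 126`). [this work] -/
theorem lawGood_X7bm123 : LawGood 7 (prof7 123) (setInd X7bSet) := by
  have h := lawGood_relab (k := 7) ((Equiv.swap (0 : Fin 7) 2).trans (Equiv.swap (1 : Fin 7) 3)) (π := prof7 126) (f := (setInd X7bSet))
    (by rw [setInd_comp_relab, show X7bSet.map (relab ((Equiv.swap (0 : Fin 7) 2).trans (Equiv.swap (1 : Fin 7) 3))).symm.toEmbedding = X7bSet by native_decide]; exact lawGood_X7b1222222)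
  have hπ : prof7 123 = prof7 126 ∘ ((Equiv.swap (0 : Fin 7) 2).trans (Equiv.swap (1 : Fin 7) 3)) := by funext i; fin_cases i <;> rfl
  rw [hπ]; exact h

/-- Interior profile `prof7 125` (relabelled from the class representative `prof7 126`). [this work] -/
theorem lawGood_X7bm125 : LawGood 7 (prof7 125) (setInd X7bSet) := by
  have h := lawGood_relab (k := 7) (Equiv.swap (0 : Fin 7) 1) (π := prof7 126) (f := (setInd X7bSet))
    (by rw [setInd_comp_relab, show X7bSet.map (relab (Equiv.swap (0 : Fin 7) 1)).symm.toEmbedding = X7bSet by native_decide]; exact lawGood_X7b1222222)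
  have hπ : prof7 125 = prof7 126 ∘ (Equiv.swap (0 : Fin 7) 1) := by funext i; fin_cases i <;> rfl
  rw [hπ]; exact h

end Summit.CriticalPhenomena.PercolationContinuityZ3.Theorems.SahiThreeCopy
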